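import Summits.BirchSwinnertonDyer.BirchSwinnertonDyer.Theses.BiquadraticEisensteinDescent

/-!
# Sketch (crux-ideate seat 2, g19) — first lemmas for the two g19 crux-idea cards on
`HeegnerTwistCouplingInSupply` (stmt-BirchSwinnertonDyer-21381). Scratch only; BSD is not proved by this.

* `JointCouplingFree` — the supply-free TRANSFER TARGET C⁺⁺ shared by both cards (the crux conclusion for
  unboundedly many Heegner fields, no supply hypothesis), and the checked reduction
  `couplingInSupply_of_jointCouplingFree : JointCouplingFree → HeegnerTwistCouplingInSupply`.
* `AdmissibleInertPrimes` — card `brandt-double-shadow`, stub S2 (level-raising primes `ℓ ≡ −1 (mod p)`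
  with `a_ℓ(W) = 0`; Dirichlet + Deuring).
* `traceDisc_isSquare` — card `ordinary-digit-hurwitz-relation`, stub T0 (in the Deuring family
  `K = ℚ(√(t² − 4pⁿ))`, `p ∤ t`, the crux prime `p` splits automatically).
-/

namespace Summit.BirchSwinnertonDyer.BirchSwinnertonDyer.Cruxes.HeegnerTwistCouplingInSupply.SketchG19

open Literature.NumberTheory.EllipticCurves

/-- C⁺⁺ (supply-free joint coupling). -/
def JointCouplingFree : Prop :=
  ∀ (W : WeierstrassCurve ℚ) [W.IsElliptic] [W.IsGloballyMinimal] (p : ℕ) [Fact p.Prime]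
    [NeZero (W.conductorNorm ℤ)],
    W.HasCM → W.analyticRank = 1 → 5 ≤ p → Rank1Residual.CMInert W p → ¬ Rank1Residual.Good W p →
    ∀ B : ℕ, ∃ (K : Type) (_ : Field K) (_ : NumberField K),
      IsImaginaryQuadratic K ∧ B < (NumberField.discr K).natAbs ∧ 4 < (NumberField.discr K).natAbs ∧
      SatisfiesHeegnerHypothesis (W.conductorNorm ℤ) K ∧
      (W.quadraticTwist (NumberField.discr K : ℚ)).entireLFunction 1 ≠ 0 ∧
      ¬ p ∣ NumberField.classNumber K

/-- The transfer is honest: C⁺⁺ implies the crux verbatim (the supply hypothesis is simply dropped). -/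
theorem couplingInSupply_of_jointCouplingFree (h : JointCouplingFree) :
    Summit.BirchSwinnertonDyer.BirchSwinnertonDyer.Theses.BiquadraticEisensteinDescent.HeegnerTwistCouplingInSupply := by
  intro W _ _ p _ _ hCM hr hp hin hgood _hsupply
  obtain ⟨K, iF, iN, hiq, -, h4, hH, hL, hcl⟩ := h W p hCM hr hp hin hgood 0
  exact ⟨K, iF, iN, hiq, h4, hH, hL, hcl⟩

/-- Card `brandt-double-shadow`, stub S2: infinitely many level-raising primes `ℓ ≡ −1 (mod p)` that are
inert in the CM field (so `a_ℓ(W) = 0 ≡ ±(ℓ+1) (mod p)`). -/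
def AdmissibleInertPrimes : Prop :=
  ∀ (W : WeierstrassCurve ℚ) [W.IsElliptic] [W.IsGloballyMinimal] (p : ℕ) [Fact p.Prime],
    W.HasCM → 5 ≤ p → Rank1Residual.CMInert W p →
    ∀ B : ℕ, ∃ ℓ : ℕ, ℓ.Prime ∧ B < ℓ ∧ ℓ % p = p - 1 ∧ W.frobeniusTrace ℓ = 0

/-- Card `ordinary-digit-hurwitz-relation`, stub T0: in the Deuring family `d = t² − 4·pⁿ` (`n ≥ 1`) the
crux prime is automatically split (`d ≡ t²`): the nemesis of the holomorphic-projection engines (N12)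
becomes automatic on the ordinary locus. -/
theorem traceDisc_isSquare (p t n : ℕ) (hn : 0 < n) :
    IsSquare ((((t : ℤ) ^ 2 - 4 * (p : ℤ) ^ n : ℤ) : ZMod p)) := by
  refine ⟨(t : ZMod p), ?_⟩
  have hp : ((p : ℤ) : ZMod p) = 0 := by simp
  push_cast
  simp [zero_pow hn.ne', sq]

end Summit.BirchSwinnertonDyer.BirchSwinnertonDyer.Cruxes.HeegnerTwistCouplingInSupply.SketchG19
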